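import Summits.NavierStokesRegularity.NavierStokesRegularity.Theses.QuasipotentialCoercivity
import Literature.Analysis.FluidPDE.TaoClassGlue
import Literature.Analysis.FluidPDE.CheskidovShvydkoyRegularProofs
import Literature.Analysis.FluidPDE.TaoLocalisation
import Literature.Analysis.FluidPDE.AxisymmetricNoSwirlGlobal
import Literature.Analysis.FluidPDE.RapidDecayLemmas
import HarnessLib

/-!
# LINE `type-split` for crux `ActionCoercivityEnstrophy` (stmt-NavierStokesRegularity-1443) — the typed
# split along the Type-I / Type-II seam as a REGISTERED SKELETON (crux-strategist, BC2 redirect):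
# two registered stubs = the two children, kernel-checked composition `ActionCoercivityEnstrophy_of`
# concluding the crux BY NAME from the two stubs (sorries ONLY inside `stub_*`; the assembly
# `actionCoercivityEnstrophy_of_subs : II → I → X` itself is sorry-free)

Route `NavierStokesRegularity/QuasipotentialCoercivity`, deciding crux
`X = ActionCoercivityEnstrophy`: bounded forcing action in bounded time cannot buy unbounded
enstrophy — for every `ν > 0`, horizon `τ > 0` and action level `a` there is `C` with
`∫ |∇x|²_F ≤ C` for every state `x` in the two-piece REACHABLE SET `R(ν, τ, a)` (a classical,
uniformly Schwartz forced path `(w, q, g)` from rest on `[0, T₀]` with `∫₀^{T₀}∫|g|² ≤ a`, then an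
unforced classical Leray–Hopf tail `v` on `[0, T₁]`, `T₀ + T₁ ≤ τ`, `x = v T₁`).  The one-crux audit
(2026-08-17) classed `X` SUMMIT-OR-HARDER (its unforced tail contains a uniform Tao-2013-Thm-1.20
a-priori `H¹` bound).  This file is the PROVED, NON-TRIVIAL assembly of the typed decomposition

  `ScaledEnergyActionBound ∧ TypeIActionCoercivity → ActionCoercivityEnstrophy`

along the classical TYPE-I / TYPE-II seam of the regularity problem, transported to the reachable
set through the scale-invariant local kinetic energy (the Caffarelli–Kohn–Nirenberg / Seregin
quantity `A`): for a state `x : ℝ³ → ℝ³` and `M ≥ 0`,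

  `TypeI(M, x) :≡ ∀ y r, 0 < r → ∫_{B(y,r)} |x|² ≤ M · r`

(dimension of `M` = viscosity², invariant under `x ↦ λ x(λ ·)`; bounded for the `|y|⁻¹` profiles
of self-similar / Type-I blow-up, so it does NOT see Type-I singularities, while it caps kinetic-
energy concentration `∫_{B_r}|x|² ≥ M r`, i.e. every Type-II-like focusing of energy).

CHILDREN (the two hypotheses below, verbatim the `statement`s filed with
`route edit --split ActionCoercivityEnstrophy`):
* `ScaledEnergyActionBound` (II, "no Type-II inflation at bounded cost"): for every `(ν, τ, a)`
  there is `M` with `TypeI(M, x)` for EVERY `x ∈ R(ν, τ, a)`.  A uniform a-priori bound of a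
  CRITICAL (scale-invariant) quantity on the reachable set.  It does not give Clay (A) on its own:
  a Type-I blow-up keeps `TypeI(M, ·)` bounded (Leray / Nečas–Růžička–Šverák profiles are `O(|y|⁻¹)`),
  so II is compatible with blow-up; it is implied by `X` (Sobolev: `∫_{B_r}|x|² ≤ C‖∇x‖₂² r²`, and
  `≤ E ≤ τ a` for `r ≥ 1`).
* `TypeIActionCoercivity` (I, "Type-I exclusion at bounded cost"): `X` RESTRICTED to paths all of
  whose slices `w s` (`s ∈ [0, T₀]`) and `v s` (`s ∈ [0, T₁]`) obey `TypeI(M, ·)`, with `C` allowed to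
  depend on `M`.  Its unforced content is the quantitative TYPE-I EXCLUSION problem (regularity of
  suitable solutions with bounded scaled energy `sup_{z₀,r} A(z₀, r) < ∞`: open in general; known
  in the axisymmetric class, Seregin–Šverák 2009 / Seregin–Zajaczkowski 2007; reduced to Liouville
  theorems for bounded ancient mild solutions, Koch–Nadirashvili–Seregin–Šverák 2009, and
  Albritton–Barker 2019); the `L²ₜL²ₓ` forcing is subcritical under the blow-up zoom
  (`‖F‖_{L²L²} = λ^{-1/2}‖f‖_{L²L²}`), so the same Liouville conjecture governs the forced piece.  It
  does not give Clay (A) on its own: a Type-II scenario violates its hypothesis.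

WHY THE ASSEMBLY IS NOT A ONE-LINER.  Child I asks Type-I control along the WHOLE PATH (the only
form in which a Type-I hypothesis is usable by parabolic theory: ε-regularity, backward
uniqueness, Liouville), child II delivers it only for TERMINAL states of reachable paths.  The seam
is the structural fact that the reachable set is CLOSED UNDER TRUNCATION: every slice of an
admissible path is itself the terminal state of an admissible path with the same `(ν, τ, a)`.  For
tail slices `v s` this is bookkeeping (same forced piece, shorter tail); for slices `w s` of the
FORCED piece it needs (i) restriction of classical forced solutions and of UNIFORM SCHWARTZ DECAY
to `[0, s]` (`iteratedFDerivWithin` on the smaller slab: Mathlib `iteratedFDerivWithin_subset`),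
(ii) Schwartz decay of the slice `w s` from the uniform space–time decay (slice derivatives are
restrictions of joint derivatives: translation + `ContinuousLinearMap.iteratedFDerivWithin_comp_right`),
hence `w s ∈ H^∞`, and (iii) LOCAL WELL-POSEDNESS of classical Leray–Hopf solutions from the
Schwartz, divergence-free slice `w s` — Tao 2013, Thm. 5.4, PROVED in the tree
(`tao2011_smooth_local_existence_holds`, packaged as `IsTaoSolutionOn.of_tao`) — to manufacture the
zero-length free tail the reachable set demands.  This is the same monotonicity-under-stopping
that makes the quasipotential a Lyapunov functional (route thesis), now carrying weight.

THEOREMS: `norm_iteratedFDeriv_slice_le`, `hasRapidSpatialDecay_slice`,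
`hasUniformRapidDecayOn_mono_Icc`, `exists_free_tail_of_forced_slice` (local existence from a
forced slice), `reach_forced_slice`, `reach_tail_slice` (truncation closure), and the glue
`actionCoercivityEnstrophy_of_subs : ScaledEnergyActionBound → TypeIActionCoercivity →
ActionCoercivityEnstrophy` (children inlined verbatim, conclusion the route decl BY NAME).
No new definitions; sorry-free; axioms `propext`, `Classical.choice`, `Quot.sound`.

References: Caffarelli–Kohn–Nirenberg, CPAM 35 (1982) (scaled local energy `A(r)`); G. Seregin,
J. Math. Sci. 143 (2007) 2961–2968 (estimates in critical Morrey spaces: one scaled quantity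
bounds the others); G. Seregin, V. Šverák, CPDE 34 (2009) 171–201 (Type I, axisymmetric);
G. Koch, N. Nadirashvili, G. Seregin, V. Šverák, Acta Math. 203 (2009) 83–105 (Liouville);
D. Albritton, T. Barker, arXiv:1811.00502 (local Type I and Liouville); T. Tao, Anal. PDE 6 (2013)
= arXiv:1108.1165, Thm. 5.4 (local theory, proved in tree) and Thm. 1.20 (the audit's calibration).
-/

-- `Summit.<Summit>.<Problem>`: single-conjunct summit, the duplicate namespace is mandated (CONVENTIONS §2).
set_option linter.dupNamespace false

noncomputable section

open Literature.Analysis.FluidPDE MeasureTheory Set Function Filter Topology Metric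
open scoped ENNReal NNReal Pointwise ContDiff

namespace Summit.NavierStokesRegularity.NavierStokesRegularity.Cruxes.ActionCoercivityEnstrophy.TypeSplit

local notation "ℝ³" => EuclideanSpace ℝ (Fin 3)

/-! ### Slices of a jointly smooth, uniformly Schwartz path -/

section Slice

variable {X : Type*} [NormedAddCommGroup X] [NormedSpace ℝ X]
variable {F : Type*} [NormedAddCommGroup F] [NormedSpace ℝ F]

/-- **Slice derivatives are restrictions of joint derivatives.** For a field jointly smooth on the
closed slab `[0, T₀] × X` and `t ∈ [0, T₀]`, `‖Dⁿ(w t)(x)‖ ≤ ‖Dⁿ(uncurry w)(t, x)‖` (the joint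
derivative taken within the slab): `w t = (uncurry w)(a + ·) ∘ inr` with `a = (t, 0)`, the chain
rule for a continuous linear map on the right (`ContinuousLinearMap.iteratedFDerivWithin_comp_right`)
after a translation (`iteratedFDerivWithin_comp_add_left`), and `‖inr‖ ≤ 1`. [folklore] -/
theorem norm_iteratedFDeriv_slice_le {T₀ : ℝ} (hT₀ : 0 < T₀) {w : ℝ → X → F}
    (h : IsSmoothSpaceTimeOn (Icc 0 T₀) w) {t : ℝ} (ht : t ∈ Icc 0 T₀) (n : ℕ) (x : X) :
    ‖iteratedFDeriv ℝ n (w t) x‖ ≤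
      ‖iteratedFDerivWithin ℝ n (uncurry w) (Icc 0 T₀ ×ˢ univ) (t, x)‖ := by
  set a : ℝ × X := (t, 0) with ha
  set s : Set (ℝ × X) := Icc (-t) (T₀ - t) ×ˢ univ with hs
  -- membership in the translated slab
  have hsT : ∀ z : ℝ × X, z ∈ s ↔ a + z ∈ Icc (0 : ℝ) T₀ ×ˢ (univ : Set X) := by
    rintro ⟨r, y⟩
    simp only [hs, ha, Prod.mk_add_mk, mem_prod, mem_Icc, mem_univ, and_true]
    constructor <;> rintro ⟨h1, h2⟩ <;> constructor <;> linarith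
  have hvadd : a +ᵥ s = Icc (0 : ℝ) T₀ ×ˢ (univ : Set X) := by
    ext z
    rw [mem_vadd_set_iff_neg_vadd_mem, hsT, vadd_eq_add, add_neg_cancel_left]
  have hsU : UniqueDiffOn ℝ s :=
    (uniqueDiffOn_Icc (by linarith [ht.1, ht.2] : -t < T₀ - t)).prod uniqueDiffOn_univ
  have hGs : ContDiffOn ℝ n (fun z : ℝ × X => uncurry w (a + z)) s := by
    have h1 : ContDiffOn ℝ n (uncurry w) (Icc (0 : ℝ) T₀ ×ˢ (univ : Set X)) :=
      h.of_le (by exact_mod_cast le_top)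
    exact h1.comp (contDiff_const.add contDiff_id).contDiffOn fun z hz => (hsT z).1 hz
  have hpre : (ContinuousLinearMap.inr ℝ ℝ X) ⁻¹' s = univ := by
    refine eq_univ_of_forall fun y => ?_
    rw [mem_preimage, hsT]
    simpa [ha] using ht
  have hx : (ContinuousLinearMap.inr ℝ ℝ X) x ∈ s := by
    rw [← mem_preimage, hpre]; exact mem_univ _
  have hpreU : UniqueDiffOn ℝ ((ContinuousLinearMap.inr ℝ ℝ X) ⁻¹' s) := by
    rw [hpre]; exact uniqueDiffOn_univ
  have hcomp := ContinuousLinearMap.iteratedFDerivWithin_comp_right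
    (ContinuousLinearMap.inr ℝ ℝ X) hGs hsU hpreU hx le_rfl
  rw [hpre, iteratedFDerivWithin_univ] at hcomp
  have hslice : ((fun z : ℝ × X => uncurry w (a + z)) ∘ (ContinuousLinearMap.inr ℝ ℝ X)) = w t := by
    funext y
    simp [ha]
  rw [hslice] at hcomp
  have htrans : iteratedFDerivWithin ℝ n (fun z : ℝ × X => uncurry w (a + z)) s
      ((ContinuousLinearMap.inr ℝ ℝ X) x) =
      iteratedFDerivWithin ℝ n (uncurry w) (Icc (0 : ℝ) T₀ ×ˢ (univ : Set X)) (t, x) := by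
    rw [iteratedFDerivWithin_comp_add_left n a, hvadd]
    congr 1
    simp [ha]
  rw [hcomp, htrans]
  refine (ContinuousMultilinearMap.norm_compContinuousLinearMap_le _ _).trans ?_
  exact mul_le_of_le_one_right (norm_nonneg _) (Finset.prod_le_one (fun _ _ => norm_nonneg _)
    fun _ _ => ContinuousLinearMap.norm_inr_le_one ℝ ℝ X)

/-- **Uniform Schwartz decay restricts to sub-slabs**: on `[0, s] ⊆ [0, T₀]`, `0 < s`, the joint
derivatives within the smaller slab agree with those within the larger one
(Mathlib `iteratedFDerivWithin_subset`), so the uniform decay constants are inherited. [folklore] -/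
theorem hasUniformRapidDecayOn_mono_Icc {T₀ s : ℝ} {w : ℝ → X → F}
    (h : IsSmoothSpaceTimeOn (Icc 0 T₀) w) (hd : HasUniformRapidDecayOn (Icc 0 T₀) w)
    (hs0 : 0 < s) (hsT : s ≤ T₀) : HasUniformRapidDecayOn (Icc 0 s) w := by
  intro n K
  obtain ⟨C, hC⟩ := hd n K
  refine ⟨C, fun t ht x => ?_⟩
  have hsub : Icc (0 : ℝ) s ×ˢ (univ : Set X) ⊆ Icc 0 T₀ ×ˢ univ :=
    prod_mono (Icc_subset_Icc_right hsT) Subset.rfl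
  rw [iteratedFDerivWithin_subset hsub ((uniqueDiffOn_Icc hs0).prod uniqueDiffOn_univ)
    ((uniqueDiffOn_Icc (hs0.trans_le hsT)).prod uniqueDiffOn_univ)
    (h.of_le (by exact_mod_cast le_top)) (mk_mem_prod ht (mem_univ x))]
  exact hC t (Icc_subset_Icc_right hsT ht) x

end Slice

/-- **Slices of a uniformly Schwartz path are Schwartz**: `HasRapidSpatialDecay (w t)` for
`t ∈ [0, T₀]` (from `norm_iteratedFDeriv_slice_le`). [folklore] -/
theorem hasRapidSpatialDecay_slice {T₀ : ℝ} (hT₀ : 0 < T₀) {w : ℝ → ℝ³ → ℝ³}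
    (h : IsSmoothSpaceTimeOn (Icc 0 T₀) w) (hd : HasUniformRapidDecayOn (Icc 0 T₀) w)
    {t : ℝ} (ht : t ∈ Icc 0 T₀) : HasRapidSpatialDecay (w t) := by
  intro n K
  obtain ⟨C, hC⟩ := hd n K
  exact ⟨C, fun x => (mul_le_mul_of_nonneg_left (norm_iteratedFDeriv_slice_le hT₀ h ht n x)
    (by positivity)).trans (hC t ht x)⟩

/-! ### Local well-posedness from a forced slice (Tao 2013, Thm. 5.4, proved in tree) -/

/-- **A zero-length free tail exists from every slice of an admissible forced piece.** If
`(w, q, g)` is a classical forced solution on `[0, T₀] × ℝ³`, uniformly Schwartz, then from every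
slice `w s`, `s ∈ [0, T₀]` — which is smooth, divergence free and Schwartz, hence `H^∞` — there is
a classical UNFORCED solution `(v, pv)` on some `[0, T₂)`, `T₂ > 0`, Leray–Hopf on `[0, T₂]` from
`w s`, with `v 0 = w s` (Tao 2013, Thm. 5.4 (ii)+(iv): `tao2011_smooth_local_existence_holds`,
lifespan `c ν³ / (‖w s‖⁴_{H¹} + 1)`). [cite: Tao2011, Thm. 5.4 (ii)+(iv)] -/
theorem exists_free_tail_of_forced_slice {ν T₀ : ℝ} (hν : 0 < ν) (hT₀ : 0 < T₀)
    {w g : ℝ → ℝ³ → ℝ³} {q : ℝ → ℝ³ → ℝ}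
    (hsol : IsClassicalNSSolutionOn (Icc 0 T₀) ν g w q) (hd : HasUniformRapidDecayOn (Icc 0 T₀) w)
    {s : ℝ} (hs : s ∈ Icc 0 T₀) :
    ∃ T₂ : ℝ, 0 < T₂ ∧ ∃ (v : ℝ → ℝ³ → ℝ³) (pv : ℝ → ℝ³ → ℝ),
      IsClassicalNSSolutionOn (Ico 0 T₂) ν 0 v pv ∧ IsLerayHopfOn T₂ ν 0 (w s) v ∧ v 0 = w s := by
  have hsm : ContDiff ℝ ∞ (w s) := hsol.contDiff_velocity hs
  have hdiv : VectorCalculus.IsDivFree (w s) := hsol.divFree s hs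
  have hdec : HasRapidSpatialDecay (w s) :=
    hasRapidSpatialDecay_slice hT₀ hsol.smooth_velocity hd hs
  have hH : ∀ n : ℕ, ∫⁻ x, ‖iteratedFDeriv ℝ n (w s) x‖ₑ ^ 2 < ⊤ := fun n =>
    hdec.lintegral_enorm_iteratedFDeriv_sq_lt_top n
  set A₀ : ℝ≥0∞ := (∫⁻ x, ‖w s x‖ₑ ^ 2) +
    ∫⁻ x, ENNReal.ofReal (frobeniusNormSq (fderiv ℝ (w s) x)) with hA₀
  have hA₀top : A₀ < ⊤ := by
    refine ENNReal.add_lt_top.2 ⟨?_, ?_⟩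
    · rw [lintegral_enorm_sq_eq_lintegral_iteratedFDeriv_zero]
      exact hH 0
    · exact (lintegral_frobeniusNormSq_le_three_mul _).trans_lt
        (ENNReal.mul_lt_top (by simp) (hH 1))
  set A : ℝ := A₀.toReal with hA
  have hA0 : 0 ≤ A := ENNReal.toReal_nonneg
  have hAle : A₀ ≤ ENNReal.ofReal A := (ENNReal.ofReal_toReal hA₀top.ne).ge
  obtain ⟨c, hc, hE⟩ := IsTaoSolutionOn.of_tao tao2011_smooth_local_existence_holds
  set T : ℝ := c * ν ^ 3 / (A ^ 2 + 1) with hTdef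
  have hT : 0 < T := by positivity
  have hAT : A ^ 2 * T ≤ c * ν ^ 3 := by
    rw [hTdef, mul_div_assoc', div_le_iff₀ (by positivity)]
    nlinarith [sq_nonneg A, mul_pos hc (pow_pos hν 3)]
  obtain ⟨u, p, hu⟩ := hE hν hT hsm hdiv hH hA0 hAle hAT
  exact ⟨T, hT, u, p, hu.classical.mono Ico_subset_Icc_self (uniqueDiffOn_Ico 0 T),
    hu.isLerayHopfOn hT, hu.initial⟩

/-! ### Truncation closure of the reachable set -/

/-- **Forced slices are reachable.** Every slice `w s`, `0 < s ≤ T₀`, of the forced piece of an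
admissible path (`T₀ ≤ τ`) is the terminal state of an admissible path with the same `(ν, τ, a)`:
forced piece `w|[0, s]` (action only decreases), free tail of length `0` inside the local classical
solution from `w s` (`exists_free_tail_of_forced_slice`). [folklore] -/
theorem reach_forced_slice {ν τ T₀ : ℝ} {a : ℝ≥0} (hν : 0 < ν) (hT₀ : 0 < T₀) (hT₀τ : T₀ ≤ τ)
    {w g : ℝ → ℝ³ → ℝ³} {q : ℝ → ℝ³ → ℝ}
    (hsol : IsClassicalNSSolutionOn (Icc 0 T₀) ν g w q) (hd : HasUniformRapidDecayOn (Icc 0 T₀) w)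
    (hw0 : w 0 = 0) (hact : (∫⁻ r in Icc 0 T₀, eEnergy (g r)) ≤ (a : ℝ≥0∞))
    {s : ℝ} (hs0 : 0 < s) (hsT : s ≤ T₀) :
    ∃ (T₀' T₁ : ℝ) (w' : ℝ → ℝ³ → ℝ³) (q' : ℝ → ℝ³ → ℝ) (g' : ℝ → ℝ³ → ℝ³),
      (0 < T₀' ∧ IsClassicalNSSolutionOn (Icc 0 T₀') ν g' w' q' ∧
        HasUniformRapidDecayOn (Icc 0 T₀') w' ∧ w' 0 = 0 ∧
        (∫⁻ r in Icc 0 T₀', eEnergy (g' r)) ≤ (a : ℝ≥0∞)) ∧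
      (0 ≤ T₁ ∧ T₀' + T₁ ≤ τ ∧ ∃ (T₂ : ℝ) (v : ℝ → ℝ³ → ℝ³) (pv : ℝ → ℝ³ → ℝ),
        T₁ < T₂ ∧ IsClassicalNSSolutionOn (Ico 0 T₂) ν 0 v pv ∧
        IsLerayHopfOn T₂ ν 0 (w' T₀') v ∧ v 0 = w' T₀' ∧ v T₁ = w s) := by
  obtain ⟨T₂, hT₂, v, pv, hv, hLH, hv0⟩ :=
    exists_free_tail_of_forced_slice hν hT₀ hsol hd ⟨hs0.le, hsT⟩
  refine ⟨s, 0, w, q, g, ⟨hs0, hsol.mono (Icc_subset_Icc_right hsT) (uniqueDiffOn_Icc hs0),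
    hasUniformRapidDecayOn_mono_Icc hsol.smooth_velocity hd hs0 hsT, hw0,
    (lintegral_mono_set (Icc_subset_Icc_right hsT)).trans hact⟩,
    ⟨le_rfl, by linarith, T₂, v, pv, hT₂, hv, hLH, hv0, hv0⟩⟩

/-! ### The assembly -/

/-- **Typed split of the deciding crux (BC2 redirect):**
`ScaledEnergyActionBound → TypeIActionCoercivity → ActionCoercivityEnstrophy`.
Given `(ν, τ, a)`, child II gives `M` with Type-I control of every reachable STATE; by truncation
closure (`reach_forced_slice` for the forced piece — local well-posedness from Schwartz slices,
Tao 2013 Thm. 5.4 — and re-reading a shorter tail for the free piece, the slice `w 0 = 0` being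
trivial) every SLICE of an admissible path is Type-I controlled with that `M`, so child I applies
with `C = C(ν, τ, a, M)`. [folklore] -/
theorem actionCoercivityEnstrophy_of_subs :
    (∀ ν : ℝ, 0 < ν → ∀ τ : ℝ, 0 < τ → ∀ a : NNReal, ∃ M : NNReal, ∀ x : EuclideanSpace ℝ (Fin 3) → EuclideanSpace ℝ (Fin 3), (∃ (T₀ T₁ : ℝ) (w : ℝ → EuclideanSpace ℝ (Fin 3) → EuclideanSpace ℝ (Fin 3)) (q : ℝ → EuclideanSpace ℝ (Fin 3) → ℝ) (g : ℝ → EuclideanSpace ℝ (Fin 3) → EuclideanSpace ℝ (Fin 3)), (0 < T₀ ∧ Literature.Analysis.FluidPDE.IsClassicalNSSolutionOn (Set.Icc 0 T₀) ν g w q ∧ Literature.Analysis.FluidPDE.HasUniformRapidDecayOn (Set.Icc 0 T₀) w ∧ w 0 = 0 ∧ (∫⁻ s in Set.Icc 0 T₀, Literature.Analysis.FluidPDE.eEnergy (g s)) ≤ (a : ENNReal)) ∧ (0 ≤ T₁ ∧ T₀ + T₁ ≤ τ ∧ ∃ (T₂ : ℝ) (v : ℝ → EuclideanSpace ℝ (Fin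 3) → EuclideanSpace ℝ (Fin 3)) (pv : ℝ → EuclideanSpace ℝ (Fin 3) → ℝ), T₁ < T₂ ∧ Literature.Analysis.FluidPDE.IsClassicalNSSolutionOn (Set.Ico 0 T₂) ν 0 v pv ∧ Literature.Analysis.FluidPDE.IsLerayHopfOn T₂ ν 0 (w T₀) v ∧ v 0 = w T₀ ∧ v T₁ = x)) → ∀ (y : EuclideanSpace ℝ (Fin 3)) (r : ℝ), 0 < r → (∫⁻ z in Metric.ball y r, ‖x z‖ₑ ^ 2) ≤ (M : ENNReal) * ENNReal.ofReal r) →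
    (∀ ν : ℝ, 0 < ν → ∀ τ : ℝ, 0 < τ → ∀ a : NNReal, ∀ M : NNReal, ∃ C : NNReal, ∀ x : EuclideanSpace ℝ (Fin 3) → EuclideanSpace ℝ (Fin 3), (∃ (T₀ T₁ : ℝ) (w : ℝ → EuclideanSpace ℝ (Fin 3) → EuclideanSpace ℝ (Fin 3)) (q : ℝ → EuclideanSpace ℝ (Fin 3) → ℝ) (g : ℝ → EuclideanSpace ℝ (Fin 3) → EuclideanSpace ℝ (Fin 3)), (0 < T₀ ∧ Literature.Analysis.FluidPDE.IsClassicalNSSolutionOn (Set.Icc 0 T₀) ν g w q ∧ Literature.Analysis.FluidPDE.HasUniformRapidDecayOn (Set.Icc 0 T₀) w ∧ w 0 = 0 ∧ (∫⁻ s in Set.Icc 0 T₀, Literature.Analysis.FluidPDE.eEnergy (g s)) ≤ (a : ENNReal) ∧ (∀ s ∈ Set.Icc 0 T₀, ∀ (y : EuclideanSpace ℝ (Fin 3)) (r : ℝ), 0 < r → (∫⁻ z in Metric.ball y r, ‖w s z‖ₑ ^ 2) ≤ (M : ENNReal) * ENNReal.ofReal r)) ∧ (0 ≤ T₁ ∧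 T₀ + T₁ ≤ τ ∧ ∃ (T₂ : ℝ) (v : ℝ → EuclideanSpace ℝ (Fin 3) → EuclideanSpace ℝ (Fin 3)) (pv : ℝ → EuclideanSpace ℝ (Fin 3) → ℝ), T₁ < T₂ ∧ Literature.Analysis.FluidPDE.IsClassicalNSSolutionOn (Set.Ico 0 T₂) ν 0 v pv ∧ Literature.Analysis.FluidPDE.IsLerayHopfOn T₂ ν 0 (w T₀) v ∧ v 0 = w T₀ ∧ v T₁ = x ∧ (∀ s ∈ Set.Icc 0 T₁, ∀ (y : EuclideanSpace ℝ (Fin 3)) (r : ℝ), 0 < r → (∫⁻ z in Metric.ball y r, ‖v s z‖ₑ ^ 2) ≤ (M : ENNReal) * ENNReal.ofReal r))) → (∫⁻ y, ENNReal.ofReal (Literature.Analysis.FluidPDE.frobeniusNormSq (fderiv ℝ x y))) ≤ (C : ENNReal)) →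
    (∀ ν : ℝ, 0 < ν → ∀ τ : ℝ, 0 < τ → ∀ a : NNReal, ∃ C : NNReal, ∀ x : EuclideanSpace ℝ (Fin 3) → EuclideanSpace ℝ (Fin 3), (∃ (T₀ T₁ : ℝ) (w : ℝ → EuclideanSpace ℝ (Fin 3) → EuclideanSpace ℝ (Fin 3)) (q : ℝ → EuclideanSpace ℝ (Fin 3) → ℝ) (g : ℝ → EuclideanSpace ℝ (Fin 3) → EuclideanSpace ℝ (Fin 3)), (0 < T₀ ∧ Literature.Analysis.FluidPDE.IsClassicalNSSolutionOn (Set.Icc 0 T₀) ν g w q ∧ Literature.Analysis.FluidPDE.HasUniformRapidDecayOn (Set.Icc 0 T₀) w ∧ w 0 = 0 ∧ (∫⁻ s in Set.Icc 0 T₀, Literature.Analysis.FluidPDE.eEnergy (g s)) ≤ (a : ENNReal)) ∧ (0 ≤ T₁ ∧ T₀ + T₁ ≤ τ ∧ ∃ (T₂ : ℝ) (v : ℝ → EuclideanSpace ℝ (Fin 3) → EuclideanSpace ℝ (Fin 3)) (pv : ℝ → EuclideanSpace ℝ (Fin 3) → ℝ), T₁ < T₂ ∧ Literature.Analysis.FluidPDE.IsClassicalNSSolutionOn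 (Set.Ico 0 T₂) ν 0 v pv ∧ Literature.Analysis.FluidPDE.IsLerayHopfOn T₂ ν 0 (w T₀) v ∧ v 0 = w T₀ ∧ v T₁ = x)) → (∫⁻ y, ENNReal.ofReal (Literature.Analysis.FluidPDE.frobeniusNormSq (fderiv ℝ x y))) ≤ (C : ENNReal)) := by
  intro hII hI ν hν τ hτ a
  obtain ⟨M, hM⟩ := hII ν hν τ hτ a
  obtain ⟨C, hC⟩ := hI ν hν τ hτ a M
  refine ⟨C, ?_⟩
  rintro x ⟨T₀, T₁, w, q, g, ⟨hT₀, hsol, hdec, hw0, hact⟩, hT₁, hsum, T₂, v, pv, hT₁₂, hv, hLH, hv0, hvx⟩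
  have hT₀τ : T₀ ≤ τ := by linarith
  refine hC x ⟨T₀, T₁, w, q, g, ⟨hT₀, hsol, hdec, hw0, hact, ?_⟩, hT₁, hsum, T₂, v, pv, hT₁₂, hv,
    hLH, hv0, hvx, ?_⟩
  · -- slices of the forced piece: `w 0 = 0` is trivial, `w s` for `0 < s` is reachable
    intro s hs y r hr
    rcases hs.1.eq_or_lt with h0 | hs0
    · subst h0
      rw [hw0]
      simp
    · exact hM (w s) (reach_forced_slice hν hT₀ hT₀τ hsol hdec hw0 hact hs0 hs.2) y r hr
  · -- slices of the free tail: same forced piece, shorter tail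
    intro s hs y r hr
    exact hM (v s) ⟨T₀, s, w, q, g, ⟨hT₀, hsol, hdec, hw0, hact⟩, hs.1, by linarith [hs.2], T₂, v, pv,
      lt_of_le_of_lt hs.2 hT₁₂, hv, hLH, hv0, rfl⟩ y r hr


/-! ### Registered stubs (the two children) and the concluding composition -/

/-- **Stub II (open): `ScaledEnergyActionBound`** — Type-II exclusion at bounded cost: a uniform
bound of the scale-invariant local kinetic energy `sup_{y,r} r⁻¹ ∫_{B(y,r)} |x|²` on the reachable set.
Birth line: `Lines/birth-ScaledEnergyActionBound.lean` (uniform weak-`L³` bound + layer cake).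
[conjecture-level stub; child II verbatim] -/
theorem stub_scaledEnergyActionBound :
    ∀ ν : ℝ, 0 < ν → ∀ τ : ℝ, 0 < τ → ∀ a : NNReal, ∃ M : NNReal, ∀ x : EuclideanSpace ℝ (Fin 3) → EuclideanSpace ℝ (Fin 3), (∃ (T₀ T₁ : ℝ) (w : ℝ → EuclideanSpace ℝ (Fin 3) → EuclideanSpace ℝ (Fin 3)) (q : ℝ → EuclideanSpace ℝ (Fin 3) → ℝ) (g : ℝ → EuclideanSpace ℝ (Fin 3) → EuclideanSpace ℝ (Fin 3)), (0 < T₀ ∧ Literature.Analysis.FluidPDE.IsClassicalNSSolutionOn (Set.Icc 0 T₀) ν g w q ∧ Literature.Analysis.FluidPDE.HasUniformRapidDecayOn (Set.Icc 0 T₀) w ∧ w 0 = 0 ∧ (∫⁻ s in Set.Icc 0 T₀, Literature.Analysis.FluidPDE.eEnergy (g s)) ≤ (a : ENNReal)) ∧ (0 ≤ T₁ ∧ T₀ + T₁ ≤ τ ∧ ∃ (T₂ : ℝ) (v : ℝ → EuclideanSpace ℝ (Fin 3) → EuclideanSpace ℝ (Fin 3)) (pv : ℝ → EuclideanSpace ℝ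 (Fin 3) → ℝ), T₁ < T₂ ∧ Literature.Analysis.FluidPDE.IsClassicalNSSolutionOn (Set.Ico 0 T₂) ν 0 v pv ∧ Literature.Analysis.FluidPDE.IsLerayHopfOn T₂ ν 0 (w T₀) v ∧ v 0 = w T₀ ∧ v T₁ = x)) → ∀ (y : EuclideanSpace ℝ (Fin 3)) (r : ℝ), 0 < r → (∫⁻ z in Metric.ball y r, ‖x z‖ₑ ^ 2) ≤ (M : ENNReal) * ENNReal.ofReal r := by
  sorry

/-- **Stub I (open, hardest): `TypeIActionCoercivity`** — Type-I exclusion at bounded cost: the crux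
restricted to paths under the Type-I bound `M` along every slice, `C = C(ν, τ, a, M)`.
Birth line: `Lines/birth-TypeIActionCoercivity.lean` (energy of the controlled phase + forced
Type-I regularity from rest + quantitative unforced Type-I exclusion).
[conjecture-level stub; child I verbatim] -/
theorem stub_typeIActionCoercivity :
    ∀ ν : ℝ, 0 < ν → ∀ τ : ℝ, 0 < τ → ∀ a : NNReal, ∀ M : NNReal, ∃ C : NNReal, ∀ x : EuclideanSpace ℝ (Fin 3) → EuclideanSpace ℝ (Fin 3), (∃ (T₀ T₁ : ℝ) (w : ℝ → EuclideanSpace ℝ (Fin 3) → EuclideanSpace ℝ (Fin 3)) (q : ℝ → EuclideanSpace ℝ (Fin 3) → ℝ) (g : ℝ → EuclideanSpace ℝ (Fin 3) → EuclideanSpace ℝ (Fin 3)), (0 < T₀ ∧ Literature.Analysis.FluidPDE.IsClassicalNSSolutionOn (Set.Icc 0 T₀) ν g w q ∧ Literature.Analysis.FluidPDE.HasUniformRapidDecayOn (Set.Icc 0 T₀) w ∧ w 0 = 0 ∧ (∫⁻ s in Set.Icc 0 T₀, Literature.Analysis.FluidPDE.eEnergy (g s)) ≤ (a : ENNReal)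 ∧ (∀ s ∈ Set.Icc 0 T₀, ∀ (y : EuclideanSpace ℝ (Fin 3)) (r : ℝ), 0 < r → (∫⁻ z in Metric.ball y r, ‖w s z‖ₑ ^ 2) ≤ (M : ENNReal) * ENNReal.ofReal r)) ∧ (0 ≤ T₁ ∧ T₀ + T₁ ≤ τ ∧ ∃ (T₂ : ℝ) (v : ℝ → EuclideanSpace ℝ (Fin 3) → EuclideanSpace ℝ (Fin 3)) (pv : ℝ → EuclideanSpace ℝ (Fin 3) → ℝ), T₁ < T₂ ∧ Literature.Analysis.FluidPDE.IsClassicalNSSolutionOn (Set.Ico 0 T₂) ν 0 v pv ∧ Literature.Analysis.FluidPDE.IsLerayHopfOn T₂ ν 0 (w T₀) v ∧ v 0 = w T₀ ∧ v T₁ = x ∧ (∀ s ∈ Set.Icc 0 T₁, ∀ (y : EuclideanSpace ℝ (Fin 3)) (r : ℝ), 0 < r → (∫⁻ z in Metric.ball y r, ‖v s z‖ₑ ^ 2) ≤ (M : ENNReal) * ENNReal.ofReal r))) → (∫⁻ y, ENNReal.ofReal (Literature.Analysis.FluidPDE.frobeniusNormSq (fderiv ℝ x y))) ≤ (C : ENNReal)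 := by
  sorry

/-- **The line concludes the crux BY NAME** (skeleton theorem, A12 shape: no hypotheses, the two
registered stubs used inside; sorries live ONLY in `stub_*`): `ActionCoercivityEnstrophy` from
`stub_scaledEnergyActionBound` (child II) and `stub_typeIActionCoercivity` (child I) by the sorry-free
assembly `actionCoercivityEnstrophy_of_subs` (truncation closure of the reachable set). -/
theorem ActionCoercivityEnstrophy_of :
    Summit.NavierStokesRegularity.NavierStokesRegularity.Theses.QuasipotentialCoercivity.ActionCoercivityEnstrophy :=
  actionCoercivityEnstrophy_of_subs stub_scaledEnergyActionBound stub_typeIActionCoercivity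

end Summit.NavierStokesRegularity.NavierStokesRegularity.Cruxes.ActionCoercivityEnstrophy.TypeSplit

end
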